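import Mathlib.RingTheory.MvPowerSeries.Basic
import Mathlib.RingTheory.LocalRing.MaximalIdeal.Basic
import Mathlib.RingTheory.Ideal.Quotient.Operations
import HarnessLib

/-!
# Transport of a tower's special fibre along given identifications `E n ⧸ 𝔪·E n ≃ F n` ([Tate1967] §2.2, proof of Prop. 1)

Topic `Literature/RingTheory/AdicTopology`, namespace `Literature.RingTheory.AdicTopology.PowerSeriesTower` (the namespace of ★
`PowerSeriesTowerPresentation`).  THEOREMS ONLY (no definition, no named fact, no instance, no notation, no `sorry`), pure
commutative algebra (no schemes).

The «special-fibre quotient transport» of the Serre–Tate unit-component spine (seat S1′-α): the power-series presentation of a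
surjective tower of finite free algebras `E n` over a local ring `A` (★ `PowerSeriesTower.exists_compatible_surjective_algHom_of_specialFibre`)
consumes its special fibre through ring maps `r n : E n → F n` that are SURJECTIVE with KERNEL `𝔪_A · E n`, COMPATIBLE with the two
towers' transition maps, and carry the constants `algebraMap A (E n) a` to the constants `ψ n (C (κ a))` of the given power-series
maps `ψ n : k⟦X⟧ → F n`.  When the special fibre is known through ring ISOMORPHISMS `θ n : E n ⧸ 𝔪_A·E n ≃ F n` — natural in `n`
and compatible with the constants (the geometric half S1′-β: «the unit component of `B[pⁿ] ×_A k` is `Spec (𝒪_{X₀,e} ⧸ [pⁿ]^♯𝔪_e)`»)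
— the maps `r n := θ n ∘ (E n ↠ E n ⧸ 𝔪_A·E n)` have exactly these four properties.  This file is that bookkeeping, once.

Cell `pub/hodgecm-mathlib`, P6b wave A∕B seat S1′-α (LA3-p03 (g8); desk F0P6b-plan (g14) «= SPLIT α∕β»); generic, count-neutral
capital `--supports stmt-HodgeConjecture-24832`; HC_CM is proved only modulo the printed citations until rung 0 closes.

## References
* [Tate1967] J. Tate, *p-divisible groups*, Proc. Conf. Local Fields (Driebergen 1966), Springer 1967, §2.2 (proof of Prop. 1: «one is
  reduced by standard procedures to the case in which R = k»).
* [Matsumura1987] H. Matsumura, *Commutative Ring Theory*, §8 (Nakayama's lemma and reduction modulo the maximal ideal).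
-/

noncomputable section

open IsLocalRing

namespace Literature.RingTheory.AdicTopology

namespace PowerSeriesTower

universe u v w w'

/-- **SPECIAL-FIBRE QUOTIENT TRANSPORT** ([Tate1967] §2.2, the reduction «to the case `R = k`» made explicit).  `A` a local ring;
`E n` a tower of `A`-algebras with transition maps `ρ`; `F n` a tower of rings with transition maps `π`; `κ : A → k` and the
«constants» `cF n : k → F n` of the `F`-tower; power-series maps `ψ n : k⟦X_σ⟧ → F n` equal to `cF n` on constants.  GIVEN ring
isomorphisms `θ n : E n ⧸ 𝔪_A·E n ≃ F n`, natural in `n` (`θ n (ρ h x mod 𝔪) = π h (θ m (x mod 𝔪))`) and compatible with the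
constants (`θ n (algebraMap A (E n) a mod 𝔪) = cF n (κ a)`), the maps `r n := θ n ∘ (· mod 𝔪_A·E n) : E n → F n` are surjective, have
kernel `𝔪_A · E n`, commute with the transition maps, and satisfy `ψ n (C (κ a)) = r n (algebraMap A (E n) a)` — verbatim the binders
`hr_surj ∕ hr_ker ∕ hrρ ∕ hψC` of ★ `exists_compatible_surjective_algHom_of_specialFibre`.
[cite: Tate1967, §2.2 (proof of Prop. 1)] [cite: Matsumura1987, §8 (Nakayama's lemma)] -/
theorem exists_specialFibre_transport
    (A : Type u) [CommRing A] [IsLocalRing A]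
    (E : ℕ → Type w) [∀ n, CommRing (E n)] [∀ n, Algebra A (E n)]
    (ρ : ∀ ⦃n m : ℕ⦄, n ≤ m → (E m →ₐ[A] E n))
    (F : ℕ → Type w') [∀ n, CommRing (F n)]
    (π : ∀ ⦃n m : ℕ⦄, n ≤ m → (F m →+* F n))
    {k : Type*} [CommRing k] (κ : A →+* k) (cF : ∀ n, k →+* F n)
    {σ : Type v} (ψ : ∀ n, MvPowerSeries σ k →+* F n)
    (hψC' : ∀ n (c : k), ψ n (MvPowerSeries.C c) = cF n c)
    (θ : ∀ n, (E n ⧸ (maximalIdeal A).map (algebraMap A (E n))) ≃+* F n)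
    (hθρ : ∀ ⦃n m : ℕ⦄ (h : n ≤ m) (x : E m),
      θ n (Ideal.Quotient.mk _ (ρ h x)) = π h (θ m (Ideal.Quotient.mk _ x)))
    (hθc : ∀ n (a : A), θ n (Ideal.Quotient.mk _ (algebraMap A (E n) a)) = cF n (κ a)) :
    ∃ r : ∀ n, E n →+* F n,
      (∀ n, Function.Surjective (r n)) ∧
      (∀ n, RingHom.ker (r n) = (maximalIdeal A).map (algebraMap A (E n))) ∧
      (∀ ⦃n m : ℕ⦄ (h : n ≤ m) (x : E m), r n (ρ h x) = π h (r m x)) ∧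
      (∀ n (a : A), ψ n (MvPowerSeries.C (κ a)) = r n (algebraMap A (E n) a)) := by
  refine ⟨fun n => (θ n).toRingHom.comp (Ideal.Quotient.mk _), fun n => ?_, fun n => ?_, fun n m h x => ?_,
    fun n a => ?_⟩
  · -- surjective: `mk` is onto and `θ n` is a bijection
    exact (θ n).surjective.comp Ideal.Quotient.mk_surjective
  · -- kernel: `θ n` is injective, so `ker (θ n ∘ mk) = ker mk = 𝔪_A · E n`
    have hθ : RingHom.ker (θ n).toRingHom = ⊥ := (RingHom.injective_iff_ker_eq_bot _).mp (θ n).injective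
    rw [← RingHom.comap_ker, hθ, ← RingHom.ker_eq_comap_bot, Ideal.mk_ker]
  · -- compatibility with the transition maps = naturality of `θ`
    exact hθρ h x
  · -- constants: `ψ n (C (κ a)) = cF n (κ a) = θ n (algebraMap a mod 𝔪)`
    rw [hψC', ← hθc]
    rfl

end PowerSeriesTower

end Literature.RingTheory.AdicTopology

end
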